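import Summits.ValiantsHypothesis.ValiantsHypothesis.Theorems.LacunarySymmetroidMatrixDescartesCensusDoorA34NodeForm

/-!
# `MatrixDescartes` census — DOOR A at `(3,4)`: NODE CHAMBERS — root TYPE = parity of the node sign vector, and no det-roots
# on simple walls of the node nomials

HONEST FRAMING.  Object-search cell `pub-symmetroid`, door-A seat `val-sym-door-p3` (g9); item stmt-ValiantsHypothesis-19980
`DoorA34 = PosRootLawAt 3 4 18` (route item `Theses.LacunarySymmetroid.DoorA34`) is OPEN and asserted nowhere in this file.
Continuation of `…CensusDoorA34NodeForm` (Cauchy–Binet `det (∑ᵢ ℓᵢ • vᵢvᵢᵀ) = ∑ᵢ Cᵢ² ∏_{j≠i} ℓⱼ`, the node / Cayley-`e₃` frame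
of a `(3,4)` symmetric net with four real nodes) and of `…CensusDoorA34RootRank/RootType` (root TYPE = semidefinite vs indefinite
degenerate conic).  For a `3 × 3` matrix `M = ∑ᵢ ℓᵢ • vᵢvᵢᵀ` spanned by four rank-one symmetric matrices — the value at ANY
`t` of ANY pencil whose letters lie in a net with four real nodes, `…NodeForm.pencil_eval_eq_sum_nodeNomial_smul` — and with NO
hypothesis on the support or on definiteness of letters:

* `quadForm_sum_four_rankOne` — `xᵀ M x = ∑ᵢ ℓᵢ (vᵢ·x)²`; `sum_four_rankOne_mulVec` — `M x = ∑ᵢ ℓᵢ (vᵢ·x) vᵢ`.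
* `posSemidef_of_posDef_add_smul_vecMulVec` — the RANK-ONE UPDATE LEMMA (any finite size): `A ≻ 0` and
  `det (A + c • v vᵀ) = 0` force `A + c • v vᵀ ⪰ 0` (inverse-free: split `x = y + α k` along a kernel vector `k`, `v·y = 0`).
* **`posSemidef_of_threePos`** — CHAMBER LAW, `3–1` chambers: if `ℓ₀, ℓ₁, ℓ₂ > 0`, the vectors `v₀,v₁,v₂` are independent
  (`det (v₀|v₁|v₂) ≠ 0`) and `det M = 0`, then `M ⪰ 0` whatever `ℓ₃` is: a det-root met while exactly ONE node nomial is negative is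
  a root of SEMIDEFINITE type (a crossing of `λ_min`); `neg_posSemidef_of_threeNeg` is the mirror (`λ_max`).
* **`exists_quadForm_neg_of_twoNeg`**, **`not_posSemidef_of_twoPos_twoNeg`** — CHAMBER LAW, `2–2` chambers: if
  `ℓ₀, ℓ₁ > 0 > ℓ₂, ℓ₃` and the four `vᵢ` span `ℝ³` (`det ∑ vᵢvᵢᵀ ≠ 0`), then `xᵀMx` takes BOTH strict signs, so neither `M` nor `−M`
  is `⪰ 0`: a det-root met while exactly TWO node nomials are negative is a root of INDEFINITE type `(1,1)` (a crossing of the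
  middle eigenvalue).  With `…NodeForm.det_sum_four_rankOne_ne_zero_of_sameSign` (no root in a `4–0` chamber) this is the
  dictionary TYPE = PARITY of the number of negative node values (node labels are arbitrary: permute).
* `det_eq_of_node_three_zero`, `det_ne_zero_of_simpleWall` — no det-root ON a simple wall: if exactly one node value vanishes
  (`ℓ₃ = 0`, `ℓ₀ℓ₁ℓ₂ ≠ 0`, `C₃ ≠ 0`) then `det M = C₃² ℓ₀ℓ₁ℓ₂ ≠ 0`; so along a pencil every positive det-root lies in an OPEN mixed
  chamber of the node nomials or on a double wall, and the inertia does not jump at simple walls.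
* pencil versions `pencil_eval_posSemidef_of_threePos`, `pencil_eval_not_posSemidef_of_twoPos_twoNeg`,
  `not_isRoot_det_pencil_of_simpleWall`.  The companion file `…DoorA34NodeInterlacing` adds the interlacing of the three
  eigenvalue branches with the four node nomials.

Reading for the census (located seat numerics, `HOME/val-sym-door-p3/g9/`, not a theorem): every four-real-node census row of
record with `17` positive roots has ALL its roots in `2–2` chambers (indefinite type, inertia walk `2121…`) and at most six
walls, in near-coincident pairs.  Nothing here bounds `ζ_sym(3,4)`; `DoorA34` stays OPEN; nothing bears on `MatrixDescartes`
(stmt-ValiantsHypothesis-18050) or on `VP ≠ VNP`.  [folklore] Sylvester inertia / Cauchy interlacing for rank-one updates; the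
secular equation; Cayley's nodal cubic (Salmon, *Geometry of Three Dimensions*); elementary.
-/

-- `Summit.ValiantsHypothesis.ValiantsHypothesis.…` repeats a component by the D-0017 layout
-- (single-conjunct summit), which the `dupNamespace` linter flags; the name is mandated.
set_option linter.dupNamespace false

namespace Summit.ValiantsHypothesis.ValiantsHypothesis.Theorems.LacunarySymmetroidMatrixDescartes.Census

open Finset
open scoped BigOperators Matrix

/-! ## Quadratic forms and the action of rank-one sums -/

/-- `xᵀ (∑ᵢ ℓᵢ • vᵢvᵢᵀ) x = ∑ᵢ ℓᵢ (vᵢ·x)²` for four rank-one symmetric `3 × 3` matrices. [folklore] -/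
theorem quadForm_sum_four_rankOne (v : Fin 4 → Fin 3 → ℝ) (ℓ : Fin 4 → ℝ) (x : Fin 3 → ℝ) :
    x ⬝ᵥ ((∑ i, ℓ i • Matrix.vecMulVec (v i) (v i)) *ᵥ x) = ∑ i, ℓ i * (v i ⬝ᵥ x) ^ 2 := by
  simp only [Matrix.mulVec, dotProduct, Matrix.sum_apply, Matrix.smul_apply, Matrix.vecMulVec_apply, smul_eq_mul,
    Fin.sum_univ_three, Fin.sum_univ_four]
  ring

/-- The matrix `∑ᵢ ℓᵢ • vᵢvᵢᵀ` is symmetric (Hermitian over `ℝ`). [folklore] -/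
theorem isHermitian_sum_four_rankOne (v : Fin 4 → Fin 3 → ℝ) (ℓ : Fin 4 → ℝ) :
    (∑ i, ℓ i • Matrix.vecMulVec (v i) (v i)).IsHermitian := by
  refine Matrix.IsHermitian.ext fun a b => ?_
  simp only [Matrix.sum_apply, Matrix.smul_apply, Matrix.vecMulVec_apply, smul_eq_mul, star_trivial]
  exact Finset.sum_congr rfl fun i _ => by ring

/-- `(∑ᵢ ℓᵢ • vᵢvᵢᵀ) x = ∑ᵢ (ℓᵢ (vᵢ·x)) • vᵢ`. [folklore] -/
theorem sum_four_rankOne_mulVec (v : Fin 4 → Fin 3 → ℝ) (ℓ : Fin 4 → ℝ) (x : Fin 3 → ℝ) :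
    (∑ i, ℓ i • Matrix.vecMulVec (v i) (v i)) *ᵥ x = ∑ i, (ℓ i * (v i ⬝ᵥ x)) • v i := by
  ext a
  simp only [Matrix.mulVec, dotProduct, Matrix.sum_apply, Matrix.smul_apply, Matrix.vecMulVec_apply, smul_eq_mul,
    Fin.sum_univ_three, Fin.sum_univ_four, Finset.sum_apply, Pi.smul_apply]
  ring

/-- If the frame spans (`det ∑ᵢ vᵢvᵢᵀ ≠ 0`), a vector orthogonal to all four `vᵢ` is zero. [folklore] -/
theorem eq_zero_of_forall_dotProduct_eq_zero (v : Fin 4 → Fin 3 → ℝ)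
    (hv : (∑ i, Matrix.vecMulVec (v i) (v i)).det ≠ 0) (x : Fin 3 → ℝ) (hx : ∀ i, v i ⬝ᵥ x = 0) : x = 0 := by
  by_contra hne
  refine hv (Matrix.exists_mulVec_eq_zero_iff.mp ⟨x, hne, ?_⟩)
  have h := sum_four_rankOne_mulVec v (fun _ => 1) x
  simp only [one_smul, one_mul] at h
  rw [h]
  simp [hx]

/-- The three rows `v₀, v₁, v₂` applied to `x` give the three pairings `vᵢ·x`. [folklore] -/
theorem rows_three_mulVec (v : Fin 4 → Fin 3 → ℝ) (x : Fin 3 → ℝ) (a : Fin 3) :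
    ((Matrix.of ![v 0, v 1, v 2]) *ᵥ x) a = (![v 0, v 1, v 2] : Fin 3 → Fin 3 → ℝ) a ⬝ᵥ x := by
  rfl

/-- If `v₀, v₁, v₂` are independent (`det (v₀;v₁;v₂) ≠ 0`, rows) and `vᵢ·x = 0` for `i = 0,1,2`, then `x = 0`. [folklore] -/
theorem eq_zero_of_three_dotProduct_eq_zero (v : Fin 4 → Fin 3 → ℝ) (hC : (Matrix.of ![v 0, v 1, v 2]).det ≠ 0)
    (x : Fin 3 → ℝ) (h0 : v 0 ⬝ᵥ x = 0) (h1 : v 1 ⬝ᵥ x = 0) (h2 : v 2 ⬝ᵥ x = 0) : x = 0 := by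
  by_contra hne
  refine hC (Matrix.exists_mulVec_eq_zero_iff.mp ⟨x, hne, ?_⟩)
  ext a
  rw [rows_three_mulVec]
  fin_cases a
  · simpa using h0
  · simpa using h1
  · simpa using h2

/-! ## The rank-one update lemma -/

/-- **Rank-one update lemma.**  If `A` is positive definite (real symmetric, any finite size) and `A + c • v vᵀ` is SINGULAR, then
`A + c • v vᵀ` is positive SEMIDEFINITE.  (Inverse-free proof: take a kernel vector `k`; `v·k ≠ 0` because `A k = −c (v·k) v` and
`A ≻ 0`; split any `x` as `y + α k` with `v·y = 0`; then `xᵀ M x = yᵀ M y = yᵀ A y ≥ 0`.)  Matrix form of «a rank-one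
perturbation of a positive definite matrix has at most one non-positive eigenvalue». [folklore] -/
theorem posSemidef_of_posDef_add_smul_vecMulVec {n : Type*} [Fintype n] [DecidableEq n]
    {A : Matrix n n ℝ} (hA : A.PosDef) (c : ℝ) (v : n → ℝ)
    (hdet : (A + c • Matrix.vecMulVec v v).det = 0) : (A + c • Matrix.vecMulVec v v).PosSemidef := by
  set M := A + c • Matrix.vecMulVec v v with hM
  have hVh : (Matrix.vecMulVec v v).IsHermitian :=
    Matrix.IsHermitian.ext fun a b => by simp [Matrix.vecMulVec_apply, mul_comm]
  have hMh : M.IsHermitian := hA.1.add (hVh.smul (isSelfAdjoint_iff.mpr (star_trivial c)))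
  have hMT : Mᵀ = M := by
    have h := hMh.eq
    rwa [Matrix.conjTranspose_eq_transpose_of_trivial] at h
  have hMx : ∀ x, M *ᵥ x = A *ᵥ x + (c * (v ⬝ᵥ x)) • v := fun x => by
    rw [hM, Matrix.add_mulVec, Matrix.smul_mulVec, Matrix.vecMulVec_mulVec, op_smul_eq_smul, smul_smul]
  obtain ⟨k, hk0, hMk⟩ := Matrix.exists_mulVec_eq_zero_iff.mpr hdet
  have hAk : A *ᵥ k = -((c * (v ⬝ᵥ k)) • v) := by
    have h := hMx k
    rw [hMk] at h
    exact eq_neg_of_add_eq_zero_left h.symm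
  have hs : v ⬝ᵥ k ≠ 0 := by
    intro hs
    have hAk0 : A *ᵥ k = 0 := by rw [hAk, hs, mul_zero, zero_smul, neg_zero]
    have hpos := hA.dotProduct_mulVec_pos hk0
    rw [hAk0, dotProduct_zero] at hpos
    exact lt_irrefl _ hpos
  refine Matrix.PosSemidef.of_dotProduct_mulVec_nonneg hMh fun x => ?_
  set α := (v ⬝ᵥ x) / (v ⬝ᵥ k) with hα
  set y := x - α • k with hy
  have hvy : v ⬝ᵥ y = 0 := by
    rw [hy, dotProduct_sub, dotProduct_smul, smul_eq_mul, hα, div_mul_cancel₀ _ hs, sub_self]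
  have hxy : x = y + α • k := by rw [hy, sub_add_cancel]
  have hMy : M *ᵥ x = M *ᵥ y := by
    rw [hxy, Matrix.mulVec_add, Matrix.mulVec_smul, hMk, smul_zero, add_zero]
  have hkMy : k ⬝ᵥ (M *ᵥ y) = 0 := by
    rw [Matrix.dotProduct_mulVec, ← hMT, Matrix.vecMul_transpose, hMk, zero_dotProduct]
  have hq : star x ⬝ᵥ (M *ᵥ x) = y ⬝ᵥ (A *ᵥ y) := by
    rw [star_trivial, hMy, hxy, add_dotProduct, smul_dotProduct, hkMy, smul_zero, add_zero, hMx y, dotProduct_add,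
      dotProduct_smul, hvy]
    simp
  rw [hq]
  have h := hA.posSemidef.dotProduct_mulVec_nonneg y
  rwa [star_trivial] at h

/-! ## Chamber law I: three positive node values (and three independent nodes) ⇒ a det-root is of SEMIDEFINITE type -/

/-- Splitting off the fourth node: `∑ᵢ ℓᵢ • vᵢvᵢᵀ = (∑ᵢ ℓ'ᵢ • vᵢvᵢᵀ) + ℓ₃ • v₃v₃ᵀ` with `ℓ' = (ℓ₀,ℓ₁,ℓ₂,0)`. [folklore] -/
theorem sum_four_rankOne_split_three (v : Fin 4 → Fin 3 → ℝ) (ℓ : Fin 4 → ℝ) :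
    (∑ i, ℓ i • Matrix.vecMulVec (v i) (v i)) =
      (∑ i, (![ℓ 0, ℓ 1, ℓ 2, 0] : Fin 4 → ℝ) i • Matrix.vecMulVec (v i) (v i)) + ℓ 3 • Matrix.vecMulVec (v 3) (v 3) := by
  simp only [Fin.sum_univ_four, Matrix.cons_val_zero, Matrix.cons_val_one, Matrix.head_cons, Matrix.cons_val_two,
    Matrix.tail_cons, Matrix.cons_val_three, zero_smul, add_zero]

/-- Three independent vectors with positive weights give a positive definite `ℓ₀ v₀v₀ᵀ + ℓ₁ v₁v₁ᵀ + ℓ₂ v₂v₂ᵀ`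
(packaged as the four-node sum with fourth weight `0`). [folklore] -/
theorem posDef_sum_three_rankOne (v : Fin 4 → Fin 3 → ℝ) (ℓ : Fin 4 → ℝ) (h0 : 0 < ℓ 0) (h1 : 0 < ℓ 1) (h2 : 0 < ℓ 2)
    (hC : (Matrix.of ![v 0, v 1, v 2]).det ≠ 0) :
    (∑ i, (![ℓ 0, ℓ 1, ℓ 2, 0] : Fin 4 → ℝ) i • Matrix.vecMulVec (v i) (v i)).PosDef := by
  refine Matrix.PosDef.of_dotProduct_mulVec_pos (isHermitian_sum_four_rankOne v _) fun x hx => ?_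
  rw [star_trivial, quadForm_sum_four_rankOne]
  simp only [Fin.sum_univ_four, Matrix.cons_val_zero, Matrix.cons_val_one, Matrix.head_cons, Matrix.cons_val_two,
    Matrix.tail_cons, Matrix.cons_val_three, zero_mul, add_zero]
  have hne : ¬ (v 0 ⬝ᵥ x = 0 ∧ v 1 ⬝ᵥ x = 0 ∧ v 2 ⬝ᵥ x = 0) := fun h =>
    hx (eq_zero_of_three_dotProduct_eq_zero v hC x h.1 h.2.1 h.2.2)
  have hsq : 0 < (v 0 ⬝ᵥ x) ^ 2 + (v 1 ⬝ᵥ x) ^ 2 + (v 2 ⬝ᵥ x) ^ 2 := by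
    by_contra hle
    push Not at hle
    apply hne
    refine ⟨?_, ?_, ?_⟩ <;> nlinarith [sq_nonneg (v 0 ⬝ᵥ x), sq_nonneg (v 1 ⬝ᵥ x), sq_nonneg (v 2 ⬝ᵥ x)]
  have hm : 0 < min (ℓ 0) (min (ℓ 1) (ℓ 2)) := lt_min h0 (lt_min h1 h2)
  nlinarith [min_le_left (ℓ 0) (min (ℓ 1) (ℓ 2)), (min_le_right (ℓ 0) (min (ℓ 1) (ℓ 2))).trans (min_le_left _ _),
    (min_le_right (ℓ 0) (min (ℓ 1) (ℓ 2))).trans (min_le_right _ _), sq_nonneg (v 0 ⬝ᵥ x), sq_nonneg (v 1 ⬝ᵥ x),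
    sq_nonneg (v 2 ⬝ᵥ x), mul_pos hm hsq]

/-- **CHAMBER LAW (`3–1` chambers ⇒ semidefinite type).**  Let `M = ∑ᵢ ℓᵢ • vᵢvᵢᵀ` with `ℓ₀, ℓ₁, ℓ₂ > 0` and `v₀, v₁, v₂`
independent (`C₃ = det (v₀;v₁;v₂) ≠ 0`).  If `det M = 0` then `M` is positive SEMIDEFINITE — whatever the sign of `ℓ₃`
(necessarily `ℓ₃ < 0`).  Along a node-frame pencil: a det-root met while three node nomials are positive and one negative is a
root of semidefinite TYPE (`tr adj > 0`, a zero of `λ_min`), never a middle-eigenvalue crossing.  Node labels are arbitrary. [folklore] -/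
theorem posSemidef_of_threePos (v : Fin 4 → Fin 3 → ℝ) (ℓ : Fin 4 → ℝ) (h0 : 0 < ℓ 0) (h1 : 0 < ℓ 1) (h2 : 0 < ℓ 2)
    (hC : (Matrix.of ![v 0, v 1, v 2]).det ≠ 0) (hdet : (∑ i, ℓ i • Matrix.vecMulVec (v i) (v i)).det = 0) :
    (∑ i, ℓ i • Matrix.vecMulVec (v i) (v i)).PosSemidef := by
  rw [sum_four_rankOne_split_three] at hdet ⊢
  exact posSemidef_of_posDef_add_smul_vecMulVec (posDef_sum_three_rankOne v ℓ h0 h1 h2 hC) (ℓ 3) (v 3) hdet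

/-- Negating all node values negates the matrix. [folklore] -/
theorem sum_four_rankOne_neg (v : Fin 4 → Fin 3 → ℝ) (ℓ : Fin 4 → ℝ) :
    (∑ i, (-ℓ i) • Matrix.vecMulVec (v i) (v i)) = -(∑ i, ℓ i • Matrix.vecMulVec (v i) (v i)) := by
  rw [← Finset.sum_neg_distrib]
  exact Finset.sum_congr rfl fun i _ => neg_smul _ _

/-- **Mirror (`1–3` chambers).**  If `ℓ₀, ℓ₁, ℓ₂ < 0`, `v₀,v₁,v₂` are independent and `det M = 0`, then `−M` is positive
semidefinite (a zero of `λ_max`). [folklore] -/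
theorem neg_posSemidef_of_threeNeg (v : Fin 4 → Fin 3 → ℝ) (ℓ : Fin 4 → ℝ) (h0 : ℓ 0 < 0) (h1 : ℓ 1 < 0) (h2 : ℓ 2 < 0)
    (hC : (Matrix.of ![v 0, v 1, v 2]).det ≠ 0) (hdet : (∑ i, ℓ i • Matrix.vecMulVec (v i) (v i)).det = 0) :
    (-(∑ i, ℓ i • Matrix.vecMulVec (v i) (v i))).PosSemidef := by
  rw [← sum_four_rankOne_neg]
  refine posSemidef_of_threePos v (fun i => -ℓ i) (neg_pos.mpr h0) (neg_pos.mpr h1) (neg_pos.mpr h2) hC ?_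
  rw [sum_four_rankOne_neg, Matrix.det_neg, hdet, mul_zero]

/-! ## Chamber law II: two positive and two negative node values (spanning frame) ⇒ INDEFINITE type -/

/-- There is a non-zero vector orthogonal to two given vectors of `ℝ³` (kernel of the `3 × 3` matrix with rows `a, b, 0`). [folklore] -/
theorem exists_ne_zero_orthogonal_two (a b : Fin 3 → ℝ) : ∃ n : Fin 3 → ℝ, n ≠ 0 ∧ a ⬝ᵥ n = 0 ∧ b ⬝ᵥ n = 0 := by
  have hdet : (Matrix.of ![a, b, 0]).det = 0 :=
    Matrix.det_eq_zero_of_row_eq_zero 2 fun j => by simp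
  obtain ⟨n, hn0, hn⟩ := Matrix.exists_mulVec_eq_zero_iff.mpr hdet
  refine ⟨n, hn0, ?_, ?_⟩
  · have h := congr_fun hn 0
    simpa [Matrix.mulVec] using h
  · have h := congr_fun hn 1
    simpa [Matrix.mulVec] using h

/-- **Two negative node values produce a negative direction.**  If `ℓ₂, ℓ₃ < 0` and the four `vᵢ` span `ℝ³`
(`det ∑ vᵢvᵢᵀ ≠ 0`), then `xᵀ M x < 0` for some `x` (a vector orthogonal to `v₀, v₁`), whatever `ℓ₀, ℓ₁` are. [folklore] -/
theorem exists_quadForm_neg_of_twoNeg (v : Fin 4 → Fin 3 → ℝ) (ℓ : Fin 4 → ℝ) (h2 : ℓ 2 < 0) (h3 : ℓ 3 < 0)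
    (hv : (∑ i, Matrix.vecMulVec (v i) (v i)).det ≠ 0) :
    ∃ x : Fin 3 → ℝ, x ⬝ᵥ ((∑ i, ℓ i • Matrix.vecMulVec (v i) (v i)) *ᵥ x) < 0 := by
  obtain ⟨n, hn0, hn0', hn1'⟩ := exists_ne_zero_orthogonal_two (v 0) (v 1)
  refine ⟨n, ?_⟩
  rw [quadForm_sum_four_rankOne]
  simp only [Fin.sum_univ_four, hn0', hn1']
  have hne : ¬ (v 2 ⬝ᵥ n = 0 ∧ v 3 ⬝ᵥ n = 0) := by
    rintro ⟨e2, e3⟩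
    refine hn0 (eq_zero_of_forall_dotProduct_eq_zero v hv n fun i => ?_)
    fin_cases i
    · exact hn0'
    · exact hn1'
    · exact e2
    · exact e3
  have hsq : 0 < (v 2 ⬝ᵥ n) ^ 2 + (v 3 ⬝ᵥ n) ^ 2 := by
    by_contra hle
    push Not at hle
    exact hne ⟨by nlinarith [sq_nonneg (v 2 ⬝ᵥ n), sq_nonneg (v 3 ⬝ᵥ n)],
      by nlinarith [sq_nonneg (v 2 ⬝ᵥ n), sq_nonneg (v 3 ⬝ᵥ n)]⟩
  have hm : max (ℓ 2) (ℓ 3) < 0 := max_lt h2 h3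
  nlinarith [le_max_left (ℓ 2) (ℓ 3), le_max_right (ℓ 2) (ℓ 3), sq_nonneg (v 2 ⬝ᵥ n), sq_nonneg (v 3 ⬝ᵥ n),
    mul_neg_of_neg_of_pos hm hsq]

/-- **Two positive node values produce a positive direction** (mirror). [folklore] -/
theorem exists_quadForm_pos_of_twoPos (v : Fin 4 → Fin 3 → ℝ) (ℓ : Fin 4 → ℝ) (h0 : 0 < ℓ 0) (h1 : 0 < ℓ 1)
    (hv : (∑ i, Matrix.vecMulVec (v i) (v i)).det ≠ 0) :
    ∃ x : Fin 3 → ℝ, 0 < x ⬝ᵥ ((∑ i, ℓ i • Matrix.vecMulVec (v i) (v i)) *ᵥ x) := by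
  obtain ⟨n, hn0, hn2', hn3'⟩ := exists_ne_zero_orthogonal_two (v 2) (v 3)
  refine ⟨n, ?_⟩
  rw [quadForm_sum_four_rankOne]
  simp only [Fin.sum_univ_four, hn2', hn3']
  have hne : ¬ (v 0 ⬝ᵥ n = 0 ∧ v 1 ⬝ᵥ n = 0) := by
    rintro ⟨e0, e1⟩
    refine hn0 (eq_zero_of_forall_dotProduct_eq_zero v hv n fun i => ?_)
    fin_cases i
    · exact e0
    · exact e1
    · exact hn2'
    · exact hn3'
  have hsq : 0 < (v 0 ⬝ᵥ n) ^ 2 + (v 1 ⬝ᵥ n) ^ 2 := by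
    by_contra hle
    push Not at hle
    exact hne ⟨by nlinarith [sq_nonneg (v 0 ⬝ᵥ n), sq_nonneg (v 1 ⬝ᵥ n)],
      by nlinarith [sq_nonneg (v 0 ⬝ᵥ n), sq_nonneg (v 1 ⬝ᵥ n)]⟩
  have hm : 0 < min (ℓ 0) (ℓ 1) := lt_min h0 h1
  nlinarith [min_le_left (ℓ 0) (ℓ 1), min_le_right (ℓ 0) (ℓ 1), sq_nonneg (v 0 ⬝ᵥ n), sq_nonneg (v 1 ⬝ᵥ n),
    mul_pos hm hsq]

/-- **CHAMBER LAW (`2–2` chambers ⇒ indefinite type).**  Let `M = ∑ᵢ ℓᵢ • vᵢvᵢᵀ` with `ℓ₀, ℓ₁ > 0 > ℓ₂, ℓ₃` and the four `vᵢ`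
spanning `ℝ³` (`det ∑ vᵢvᵢᵀ ≠ 0`).  Then neither `M` nor `−M` is positive semidefinite.  Along a node-frame pencil: a det-root met
while exactly two node nomials are negative is of INDEFINITE type — a degenerate conic that is a real line pair (`tr adj < 0`,
`…RootRank.indefinite_of_trace_adjugate_neg` in reverse), i.e. a crossing of the MIDDLE eigenvalue; and between roots the
inertia there is `(2,1)` or `(1,2)`.  Node labels are arbitrary. [folklore] -/
theorem not_posSemidef_of_twoPos_twoNeg (v : Fin 4 → Fin 3 → ℝ) (ℓ : Fin 4 → ℝ) (h0 : 0 < ℓ 0) (h1 : 0 < ℓ 1)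
    (h2 : ℓ 2 < 0) (h3 : ℓ 3 < 0) (hv : (∑ i, Matrix.vecMulVec (v i) (v i)).det ≠ 0) :
    ¬ (∑ i, ℓ i • Matrix.vecMulVec (v i) (v i)).PosSemidef ∧ ¬ (-(∑ i, ℓ i • Matrix.vecMulVec (v i) (v i))).PosSemidef := by
  constructor
  · intro hpsd
    obtain ⟨x, hx⟩ := exists_quadForm_neg_of_twoNeg v ℓ h2 h3 hv
    have h := hpsd.dotProduct_mulVec_nonneg x
    rw [star_trivial] at h
    exact absurd hx (not_lt.mpr h)
  · intro hpsd
    obtain ⟨x, hx⟩ := exists_quadForm_pos_of_twoPos v ℓ h0 h1 hv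
    have h := hpsd.dotProduct_mulVec_nonneg x
    rw [star_trivial, Matrix.neg_mulVec, dotProduct_neg] at h
    exact absurd hx (not_lt.mpr (neg_nonneg.mp h))

/-! ## No det-root on a simple wall -/

/-- The cofactor `C₃` of `det_sum_four_rankOne` is `det (v₀;v₁;v₂)` (rows). [folklore] -/
theorem cofactor_three_eq_det (v : Fin 4 → Fin 3 → ℝ) :
    v 0 0 * (v 1 1 * v 2 2 - v 2 1 * v 1 2) - v 1 0 * (v 0 1 * v 2 2 - v 2 1 * v 0 2)
        + v 2 0 * (v 0 1 * v 1 2 - v 1 1 * v 0 2) = (Matrix.of ![v 0, v 1, v 2]).det := by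
  rw [Matrix.det_fin_three]
  simp only [Matrix.of_apply, Matrix.cons_val_zero, Matrix.cons_val_one, Matrix.head_cons, Matrix.cons_val_two,
    Matrix.tail_cons]
  ring

/-- **Value on the wall `ℓ₃ = 0`.**  `det (ℓ₀ v₀v₀ᵀ + ℓ₁ v₁v₁ᵀ + ℓ₂ v₂v₂ᵀ + 0) = C₃² ℓ₀ℓ₁ℓ₂`. [folklore] -/
theorem det_eq_of_node_three_zero (v : Fin 4 → Fin 3 → ℝ) (ℓ : Fin 4 → ℝ) (h3 : ℓ 3 = 0) :
    (∑ i, ℓ i • Matrix.vecMulVec (v i) (v i)).det = (Matrix.of ![v 0, v 1, v 2]).det ^ 2 * (ℓ 0 * ℓ 1 * ℓ 2) := by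
  rw [det_sum_four_rankOne, ← cofactor_three_eq_det, h3]
  ring

/-- **No det-root on a simple wall.**  If exactly one node value vanishes (`ℓ₃ = 0`, `ℓ₀, ℓ₁, ℓ₂ ≠ 0`) and the other three nodes
are independent (`C₃ ≠ 0`), then `det (∑ᵢ ℓᵢ • vᵢvᵢᵀ) ≠ 0`.  Along a node-frame pencil: a positive det-root is never a simple zero
of exactly one node nomial — it lies in an open chamber with a MIXED sign vector (`…NodeForm`) or on a double wall; the inertia
`n₋` is continuous across simple walls.  Node labels are arbitrary. [folklore] -/
theorem det_ne_zero_of_simpleWall (v : Fin 4 → Fin 3 → ℝ) (ℓ : Fin 4 → ℝ) (h3 : ℓ 3 = 0) (h0 : ℓ 0 ≠ 0) (h1 : ℓ 1 ≠ 0)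
    (h2 : ℓ 2 ≠ 0) (hC : (Matrix.of ![v 0, v 1, v 2]).det ≠ 0) :
    (∑ i, ℓ i • Matrix.vecMulVec (v i) (v i)).det ≠ 0 := by
  rw [det_eq_of_node_three_zero v ℓ h3]
  exact mul_ne_zero (pow_ne_zero 2 hC) (mul_ne_zero (mul_ne_zero h0 h1) h2)

/-! ## Pencil versions (letters in a net with four real nodes: `S l = ∑ᵢ A i l • vᵢvᵢᵀ`, node nomials `ℓᵢ(t) = ∑ₗ A i l t^(d l)`) -/

open Polynomial in
/-- **Pencil chamber law, `3–1`.**  For a pencil whose letters are combinations of four fixed rank-one matrices, at a det-root `t`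
where the node nomials `ℓ₀, ℓ₁, ℓ₂` are positive (and `v₀,v₁,v₂` independent) the matrix `F(t)` is positive semidefinite: the root
is of semidefinite type. [folklore] -/
theorem pencil_eval_posSemidef_of_threePos {K : ℕ} (d : Fin K → ℕ) (A : Fin 4 → Fin K → ℝ) (v : Fin 4 → Fin 3 → ℝ)
    (hC : (Matrix.of ![v 0, v 1, v 2]).det ≠ 0) (t : ℝ)
    (h0 : 0 < ∑ l, A 0 l * t ^ d l) (h1 : 0 < ∑ l, A 1 l * t ^ d l) (h2 : 0 < ∑ l, A 2 l * t ^ d l)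
    (hroot : ((∑ l, (X : ℝ[X]) ^ d l • (∑ i, A i l • Matrix.vecMulVec (v i) (v i)).map C).det).IsRoot t) :
    (∑ l, t ^ d l • ∑ i, A i l • Matrix.vecMulVec (v i) (v i)).PosSemidef := by
  rw [Polynomial.IsRoot, eval_det_pencil_rankOneLetters] at hroot
  rw [pencil_eval_eq_sum_nodeNomial_smul]
  exact posSemidef_of_threePos v (fun i => ∑ l, A i l * t ^ d l) h0 h1 h2 hC hroot

open Polynomial in
/-- **Pencil chamber law, `2–2`.**  At any `t` where two node nomials are positive and two negative (frame spanning `ℝ³`),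
`F(t)` is neither positive nor negative semidefinite; in particular a det-root there is of indefinite type (a middle-eigenvalue
crossing), and off the roots the inertia there is `(2,1)` or `(1,2)`. [folklore] -/
theorem pencil_eval_not_posSemidef_of_twoPos_twoNeg {K : ℕ} (d : Fin K → ℕ) (A : Fin 4 → Fin K → ℝ)
    (v : Fin 4 → Fin 3 → ℝ) (hv : (∑ i, Matrix.vecMulVec (v i) (v i)).det ≠ 0) (t : ℝ)
    (h0 : 0 < ∑ l, A 0 l * t ^ d l) (h1 : 0 < ∑ l, A 1 l * t ^ d l) (h2 : ∑ l, A 2 l * t ^ d l < 0)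
    (h3 : ∑ l, A 3 l * t ^ d l < 0) :
    ¬ (∑ l, t ^ d l • ∑ i, A i l • Matrix.vecMulVec (v i) (v i)).PosSemidef ∧
      ¬ (-(∑ l, t ^ d l • ∑ i, A i l • Matrix.vecMulVec (v i) (v i))).PosSemidef := by
  rw [pencil_eval_eq_sum_nodeNomial_smul]
  exact not_posSemidef_of_twoPos_twoNeg v (fun i => ∑ l, A i l * t ^ d l) h0 h1 h2 h3 hv

open Polynomial in
/-- **Pencil wall law.**  A `t` at which exactly one node nomial vanishes (`ℓ₃(t) = 0`, the other three non-zero, `v₀,v₁,v₂`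
independent) is NOT a det-root of the pencil. [folklore] -/
theorem not_isRoot_det_pencil_of_simpleWall {K : ℕ} (d : Fin K → ℕ) (A : Fin 4 → Fin K → ℝ) (v : Fin 4 → Fin 3 → ℝ)
    (hC : (Matrix.of ![v 0, v 1, v 2]).det ≠ 0) (t : ℝ) (h3 : ∑ l, A 3 l * t ^ d l = 0)
    (h0 : ∑ l, A 0 l * t ^ d l ≠ 0) (h1 : ∑ l, A 1 l * t ^ d l ≠ 0) (h2 : ∑ l, A 2 l * t ^ d l ≠ 0) :
    ¬ ((∑ l, (X : ℝ[X]) ^ d l • (∑ i, A i l • Matrix.vecMulVec (v i) (v i)).map C).det).IsRoot t := by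
  rw [Polynomial.IsRoot, eval_det_pencil_rankOneLetters]
  exact det_ne_zero_of_simpleWall v (fun i => ∑ l, A i l * t ^ d l) h3 h0 h1 h2 hC

end Summit.ValiantsHypothesis.ValiantsHypothesis.Theorems.LacunarySymmetroidMatrixDescartes.Census
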